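import Summits.Parity.GeneralizedHardyLittlewood.Theorems.PrimeLevelFamEdgeMomentsBeyondDiagonalLayersHigherTaylor
import HarnessLib

/-!
# Route `PrimeLevelFamEdge`, crux K_A `MomentsBeyondDiagonal` (stmt-Parity-20007), line «petersson_layers» v4:
# the `ℓ²` SIZES and the SUPPORT of the class coefficients of `stub_farP`'s `k = 0` forms (assembly step E4, inputs)

For a sharp class `(s₁,t₁,s₂,t₂)` of a `(d₁,d₂)`-block (`…LayersClassSplit.sum_four_kloosterman_eq_sum_classes` applied to the
`k = 0` form of `…LayersFormReductionZero`), the coefficients of the dilated bilinear Kloosterman form are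
`A(f₁,f₂) = 1_{flats}·x_{d₁s₁f₁}x_{d₂s₂f₂}√(s₁f₁·s₂f₂)` on `f₁ ≤ M/d₁/s₁`, `f₂ ≤ M/d₂/s₂` and
`B(h₁,h₂) = 1_{flats}·1_{d₁t₁h₁·d₂t₂h₂ ≤ Y}(d₁t₁h₁·d₂t₂h₂)^{−1/2}W_{ij}(d₁t₁h₁, d₂t₂h₂)√(t₁h₁·t₂h₂)` on `hᵢ ≤ q²/dᵢ/tᵢ`:
* `normSq_sum_classMollifier_le`: `Σ‖A‖² ≤ B⁴ · (M/d₁/s₁)(M/d₂/s₂)` (`|x_m|√m ≤ B`);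
* `classAFE_eq_zero_of_lt`: `B(h₁,h₂) = 0` once `h₁h₂ > Y/(d₁t₁·d₂t₂)` (the hyperbolic support, input `hB` of
  `…LayersClassPascadi.norm_sum_four_le_of_pascadi_hyperbolic`);
* `normSq_sum_classAFE_le`: `Σ‖B‖² ≤ (K L)² (1 + 2log q) · Y/(d₁t₁·d₂t₂)` (`‖(N₁N₂)^{−1/2}W‖√(N₁N₂) ≤ KL`, hyperbola count).
Remaining (census E4'–E7): plugging these into the per-class inequality, the class count, `q ∣ r`, exponents; NOT done here.
Proof only (def-free helper); K_A NOT proved; nothing about Landau–Siegel zeros.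
-/

noncomputable section

open scoped Real Nat
open Complex Finset Polynomial MeasureTheory
open Literature.NumberTheory.LFunctions

namespace Summit.Parity.GeneralizedHardyLittlewood.Theorems.MomentsBeyondDiagonal.Layers

open Summit.Parity.GeneralizedHardyLittlewood.Theorems.PrimeLevelFamEdgeIdeaDeltas.PeterssonLayers

/-! ## §1. Mollifier side -/

/-- `‖x_{d(sf)}‖ · √(sf) ≤ B` for `f ≤ M/d/s` (`d, s ≥ 1`; `|x_m| ≤ B m^{−1/2}`). [folklore] -/
theorem norm_mollifierCoeff_mul_sqrt_le {q : ℕ} [NeZero q] (h64 : 64 ≤ q) {P : ℝ[X]} {B : ℝ}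
    (hB : ∀ t ∈ Set.Icc (0 : ℝ) 1, |P.eval t| ≤ B) {Δ' : ℝ} (hΔ' : 0 < Δ') {d s f : ℕ} (hd : 1 ≤ d) (hs : 1 ≤ s)
    (hf : f ∈ Icc 1 (⌊KMV2000.qhat q ^ Δ'⌋₊ / d / s)) :
    ‖(KMV2000.mollifierCoeff P (KMV2000.qhat q ^ Δ') (d * (s * f)) : ℂ)‖ * Real.sqrt ((s * f : ℕ) : ℝ) ≤ B := by
  have hqh1 : 1 < KMV2000.qhat q := one_lt_qhat h64
  have hM1 : 1 < KMV2000.qhat q ^ Δ' := Real.one_lt_rpow hqh1 hΔ'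
  have hB0 : 0 ≤ B := le_trans (abs_nonneg _) (hB 0 (by simp))
  have hsf : s * f ∈ Icc 1 (⌊KMV2000.qhat q ^ Δ'⌋₊ / d) := mul_mem_Icc_of_mem_div hs hf
  have hdsf : d * (s * f) ∈ Icc 1 ⌊KMV2000.qhat q ^ Δ'⌋₊ := mul_mem_Icc_of_mem_div hd hsf
  have hx := norm_mollifierCoeff_le hB hM1 hdsf
  have hy := rpow_neg_half_mul_sqrt_le_one hd (mem_Icc.mp hsf).1
  calc _ ≤ B * ((d * (s * f) : ℕ) : ℝ) ^ (-(1 / 2 : ℝ)) * Real.sqrt ((s * f : ℕ) : ℝ) :=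
        mul_le_mul_of_nonneg_right hx (Real.sqrt_nonneg _)
    _ = B * (((d * (s * f) : ℕ) : ℝ) ^ (-(1 / 2 : ℝ)) * Real.sqrt ((s * f : ℕ) : ℝ)) := by ring
    _ ≤ B * 1 := mul_le_mul_of_nonneg_left hy hB0
    _ = B := mul_one B

/-- **Mollifier side of a class**: `Σ_{f₁≤M/d₁/s₁, f₂≤M/d₂/s₂} ‖1_{flats}·x_{d₁s₁f₁}x_{d₂s₂f₂}√(s₁f₁)√(s₂f₂)‖²
≤ B⁴ · (M/d₁/s₁) · (M/d₂/s₂)`. [folklore] -/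
theorem normSq_sum_classMollifier_le {q : ℕ} [NeZero q] (h64 : 64 ≤ q) {P : ℝ[X]} {B : ℝ}
    (hB : ∀ t ∈ Set.Icc (0 : ℝ) 1, |P.eval t| ≤ B) {Δ' : ℝ} (hΔ' : 0 < Δ') (c : ℕ) {d₁ d₂ s₁ s₂ : ℕ}
    (hd₁ : 1 ≤ d₁) (hd₂ : 1 ≤ d₂) (hs₁ : 1 ≤ s₁) (hs₂ : 1 ≤ s₂) :
    ∑ p ∈ Icc 1 (⌊KMV2000.qhat q ^ Δ'⌋₊ / d₁ / s₁) ×ˢ Icc 1 (⌊KMV2000.qhat q ^ Δ'⌋₊ / d₂ / s₂),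
      ‖(if Nat.Coprime p.1 c ∧ Nat.Coprime p.2 c then
          (KMV2000.mollifierCoeff P (KMV2000.qhat q ^ Δ') (d₁ * (s₁ * p.1)) : ℂ) *
            (KMV2000.mollifierCoeff P (KMV2000.qhat q ^ Δ') (d₂ * (s₂ * p.2)) : ℂ) *
            ((Real.sqrt ((s₁ * p.1 : ℕ) : ℝ) * Real.sqrt ((s₂ * p.2 : ℕ) : ℝ) : ℝ) : ℂ) else 0)‖ ^ 2 ≤
      B ^ 4 * (((⌊KMV2000.qhat q ^ Δ'⌋₊ / d₁ / s₁ : ℕ) : ℝ) * ((⌊KMV2000.qhat q ^ Δ'⌋₊ / d₂ / s₂ : ℕ) : ℝ)) := by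
  have hB0 : 0 ≤ B := le_trans (abs_nonneg _) (hB 0 (by simp))
  have hterm : ∀ p ∈ Icc 1 (⌊KMV2000.qhat q ^ Δ'⌋₊ / d₁ / s₁) ×ˢ Icc 1 (⌊KMV2000.qhat q ^ Δ'⌋₊ / d₂ / s₂),
      ‖(if Nat.Coprime p.1 c ∧ Nat.Coprime p.2 c then
          (KMV2000.mollifierCoeff P (KMV2000.qhat q ^ Δ') (d₁ * (s₁ * p.1)) : ℂ) *
            (KMV2000.mollifierCoeff P (KMV2000.qhat q ^ Δ') (d₂ * (s₂ * p.2)) : ℂ) *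
            ((Real.sqrt ((s₁ * p.1 : ℕ) : ℝ) * Real.sqrt ((s₂ * p.2 : ℕ) : ℝ) : ℝ) : ℂ) else 0)‖ ^ 2 ≤ (B * B) ^ 2 := by
    intro p hp
    obtain ⟨hp₁, hp₂⟩ := mem_product.mp hp
    refine pow_le_pow_left₀ (norm_nonneg _) ?_ 2
    split_ifs
    · have h₁ := norm_mollifierCoeff_mul_sqrt_le h64 hB hΔ' hd₁ hs₁ hp₁
      have h₂ := norm_mollifierCoeff_mul_sqrt_le h64 hB hΔ' hd₂ hs₂ hp₂
      have hs : ‖((Real.sqrt ((s₁ * p.1 : ℕ) : ℝ) * Real.sqrt ((s₂ * p.2 : ℕ) : ℝ) : ℝ) : ℂ)‖ =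
          Real.sqrt ((s₁ * p.1 : ℕ) : ℝ) * Real.sqrt ((s₂ * p.2 : ℕ) : ℝ) := by
        rw [Complex.norm_real, Real.norm_eq_abs, abs_of_nonneg (by positivity)]
      rw [norm_mul, norm_mul, hs]
      calc _ = (‖(KMV2000.mollifierCoeff P (KMV2000.qhat q ^ Δ') (d₁ * (s₁ * p.1)) : ℂ)‖ *
              Real.sqrt ((s₁ * p.1 : ℕ) : ℝ)) *
            (‖(KMV2000.mollifierCoeff P (KMV2000.qhat q ^ Δ') (d₂ * (s₂ * p.2)) : ℂ)‖ *
              Real.sqrt ((s₂ * p.2 : ℕ) : ℝ)) := by ring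
        _ ≤ B * B := mul_le_mul h₁ h₂ (by positivity) hB0
    · rw [norm_zero]; positivity
  refine (sum_le_sum hterm).trans ?_
  rw [sum_const, nsmul_eq_mul, card_product, Nat.card_Icc, Nat.card_Icc, Nat.add_sub_cancel, Nat.add_sub_cancel]
  push_cast
  nlinarith [sq_nonneg B, mul_nonneg (Nat.cast_nonneg (α := ℝ) (⌊KMV2000.qhat q ^ Δ'⌋₊ / d₁ / s₁))
    (Nat.cast_nonneg (α := ℝ) (⌊KMV2000.qhat q ^ Δ'⌋₊ / d₂ / s₂))]

/-! ## §2. AFE side -/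

/-- **The hyperbolic support of a class's AFE coefficient**: if `h₁h₂ > Y/(d₁t₁·d₂t₂)` (all of `dᵢ, tᵢ ≥ 1`) then
`d₁(t₁h₁)·(d₂(t₂h₂)) > Y`, so the indicator weight vanishes. [folklore] -/
theorem classAFE_eq_zero_of_lt {d₁ d₂ t₁ t₂ Y : ℕ} (hD : 0 < d₁ * t₁ * (d₂ * t₂)) (w : ℕ → ℕ → ℂ) (c : ℕ)
    (G : ℕ → ℕ → ℂ) {h₁ h₂ : ℕ} (hlt : Y / (d₁ * t₁ * (d₂ * t₂)) < h₁ * h₂) :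
    (if Nat.Coprime h₁ c ∧ Nat.Coprime h₂ c then
        (if d₁ * (t₁ * h₁) * (d₂ * (t₂ * h₂)) ≤ Y then w (d₁ * (t₁ * h₁)) (d₂ * (t₂ * h₂)) else 0) * G h₁ h₂
      else 0) = 0 := by
  have hgt : ¬ d₁ * (t₁ * h₁) * (d₂ * (t₂ * h₂)) ≤ Y := by
    intro hle
    have : h₁ * h₂ ≤ Y / (d₁ * t₁ * (d₂ * t₂)) := by
      rw [Nat.le_div_iff_mul_le hD]
      have e : d₁ * (t₁ * h₁) * (d₂ * (t₂ * h₂)) = h₁ * h₂ * (d₁ * t₁ * (d₂ * t₂)) := by ring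
      rw [← e]; exact hle
    exact absurd hlt (not_lt.mpr this)
  rw [if_neg hgt]
  split_ifs <;> simp

/-- For `h₁ ≥ 1`: `#{h₂ ≤ N : d₁(t₁h₁)·(d₂(t₂h₂)) ≤ Y} ≤ Y/((d₁t₁)(d₂t₂)h₁)`. [folklore] -/
theorem card_filter_class_hyperbola_le {d₁ d₂ t₁ t₂ h₁ : ℕ} (hd₁ : 1 ≤ d₁) (hd₂ : 1 ≤ d₂) (ht₁ : 1 ≤ t₁) (ht₂ : 1 ≤ t₂)
    (hh₁ : 1 ≤ h₁) (N Y : ℕ) :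
    ((#((Icc 1 N).filter (fun h₂ ↦ d₁ * (t₁ * h₁) * (d₂ * (t₂ * h₂)) ≤ Y)) : ℕ) : ℝ) ≤
      (Y : ℝ) / (((d₁ * t₁ : ℕ) : ℝ) * ((d₂ * t₂ : ℕ) : ℝ) * h₁) := by
  have h := card_filter_hyperbola_le (d₁ := d₁ * t₁) (d₂ := d₂ * t₂) (n₁ := h₁)
    (Nat.one_le_iff_ne_zero.mpr (mul_ne_zero (by omega) (by omega)))
    (Nat.one_le_iff_ne_zero.mpr (mul_ne_zero (by omega) (by omega))) hh₁ N Y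
  have hset : (Icc 1 N).filter (fun h₂ ↦ d₁ * (t₁ * h₁) * (d₂ * (t₂ * h₂)) ≤ Y) =
      (Icc 1 N).filter (fun h₂ ↦ d₁ * t₁ * h₁ * (d₂ * t₂ * h₂) ≤ Y) := by
    refine filter_congr fun h₂ _ ↦ ?_
    rw [show d₁ * (t₁ * h₁) * (d₂ * (t₂ * h₂)) = d₁ * t₁ * h₁ * (d₂ * t₂ * h₂) by ring]
  rw [hset]
  exact_mod_cast h

/-- **AFE side of a class**: with `‖(N₁N₂)^{−1/2}W(N₁,N₂)‖√(N₁N₂) ≤ K L` on the AFE box,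
`Σ_{h₁≤q²/d₁/t₁, h₂≤q²/d₂/t₂} ‖1_{flats}·1_{d₁t₁h₁d₂t₂h₂≤Y}(d₁t₁h₁·d₂t₂h₂)^{−1/2}W√(t₁h₁)√(t₂h₂)‖²
≤ (K L)²(1 + 2log q) · Y/((d₁t₁)(d₂t₂))`. [folklore] -/
theorem normSq_sum_classAFE_le {q : ℕ} [NeZero q] (h64 : 64 ≤ q) (i j : ℕ) {K : ℝ} (hK0 : 0 ≤ K)
    (hK : ∀ {N₁ N₂ : ℕ}, N₁ ∈ afeBox q → N₂ ∈ afeBox q →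
      ‖((((N₁ : ℝ) * N₂) ^ (-(1 / 2 : ℝ)) : ℝ) : ℂ) * afeW (KMV2000.qhat q) i j N₁ N₂‖ *
          Real.sqrt ((N₁ : ℝ) * N₂) ≤
        K * ((1 + Real.log (KMV2000.qhat q)) * (1 + 2 * Real.log q)) ^ (i + j) *
          (KMV2000.qhat q ^ 2 / ((N₁ : ℝ) * N₂)) ^ (0 : ℝ))
    (c Y : ℕ) {d₁ d₂ t₁ t₂ : ℕ} (hd₁ : 1 ≤ d₁) (hd₂ : 1 ≤ d₂) (ht₁ : 1 ≤ t₁) (ht₂ : 1 ≤ t₂) :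
    ∑ p ∈ Icc 1 (q ^ 2 / d₁ / t₁) ×ˢ Icc 1 (q ^ 2 / d₂ / t₂),
      ‖(if Nat.Coprime p.1 c ∧ Nat.Coprime p.2 c then
          (if d₁ * (t₁ * p.1) * (d₂ * (t₂ * p.2)) ≤ Y then
              ((((((d₁ * (t₁ * p.1) : ℕ) : ℝ) * ((d₂ * (t₂ * p.2) : ℕ) : ℝ)) ^ (-(1 / 2 : ℝ)) : ℝ) : ℂ) *
                afeW (KMV2000.qhat q) i j (d₁ * (t₁ * p.1)) (d₂ * (t₂ * p.2))) else 0) *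
            ((Real.sqrt ((t₁ * p.1 : ℕ) : ℝ) * Real.sqrt ((t₂ * p.2 : ℕ) : ℝ) : ℝ) : ℂ) else 0)‖ ^ 2 ≤
      (K * ((1 + Real.log (KMV2000.qhat q)) * (1 + 2 * Real.log q)) ^ (i + j)) ^ 2 * (1 + 2 * Real.log q) *
        ((Y : ℝ) / (((d₁ * t₁ : ℕ) : ℝ) * ((d₂ * t₂ : ℕ) : ℝ))) := by
  have hqh1 : 1 < KMV2000.qhat q := one_lt_qhat h64
  have hq1 : 1 ≤ q := le_trans (by norm_num) h64
  set L : ℝ := ((1 + Real.log (KMV2000.qhat q)) * (1 + 2 * Real.log q)) ^ (i + j) with hL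
  have hlq : 0 ≤ Real.log (q : ℝ) := Real.log_nonneg (by exact_mod_cast hq1)
  have hL0 : 0 ≤ L := by
    rw [hL]
    refine pow_nonneg (mul_nonneg ?_ ?_) _
    · linarith [Real.log_nonneg hqh1.le]
    · linarith
  have hdt₁ : 1 ≤ d₁ * t₁ := Nat.one_le_iff_ne_zero.mpr (mul_ne_zero (by omega) (by omega))
  have hdt₂ : 1 ≤ d₂ * t₂ := Nat.one_le_iff_ne_zero.mpr (mul_ne_zero (by omega) (by omega))
  -- termwise: `≤ (K L)²` on the support, `0` off it
  have hterm : ∀ h₁ ∈ Icc 1 (q ^ 2 / d₁ / t₁), ∀ h₂ ∈ Icc 1 (q ^ 2 / d₂ / t₂),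
      ‖(if Nat.Coprime h₁ c ∧ Nat.Coprime h₂ c then
          (if d₁ * (t₁ * h₁) * (d₂ * (t₂ * h₂)) ≤ Y then
              ((((((d₁ * (t₁ * h₁) : ℕ) : ℝ) * ((d₂ * (t₂ * h₂) : ℕ) : ℝ)) ^ (-(1 / 2 : ℝ)) : ℝ) : ℂ) *
                afeW (KMV2000.qhat q) i j (d₁ * (t₁ * h₁)) (d₂ * (t₂ * h₂))) else 0) *
            ((Real.sqrt ((t₁ * h₁ : ℕ) : ℝ) * Real.sqrt ((t₂ * h₂ : ℕ) : ℝ) : ℝ) : ℂ) else 0)‖ ^ 2 ≤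
        if d₁ * (t₁ * h₁) * (d₂ * (t₂ * h₂)) ≤ Y then (K * L) ^ 2 else 0 := by
    intro h₁ hh₁ h₂ hh₂
    by_cases hY : d₁ * (t₁ * h₁) * (d₂ * (t₂ * h₂)) ≤ Y
    · rw [if_pos hY, if_pos hY]
      have key : ‖(if Nat.Coprime h₁ c ∧ Nat.Coprime h₂ c then
          ((((((d₁ * (t₁ * h₁) : ℕ) : ℝ) * ((d₂ * (t₂ * h₂) : ℕ) : ℝ)) ^ (-(1 / 2 : ℝ)) : ℝ) : ℂ) *
              afeW (KMV2000.qhat q) i j (d₁ * (t₁ * h₁)) (d₂ * (t₂ * h₂))) *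
            ((Real.sqrt ((t₁ * h₁ : ℕ) : ℝ) * Real.sqrt ((t₂ * h₂ : ℕ) : ℝ) : ℝ) : ℂ) else 0)‖ ≤ K * L := by
        split_ifs
        · have hN₁ : d₁ * (t₁ * h₁) ∈ afeBox q := by
            unfold afeBox; exact mul_mem_Icc_of_mem_div hd₁ (mul_mem_Icc_of_mem_div ht₁ hh₁)
          have hN₂ : d₂ * (t₂ * h₂) ∈ afeBox q := by
            unfold afeBox; exact mul_mem_Icc_of_mem_div hd₂ (mul_mem_Icc_of_mem_div ht₂ hh₂)
          have hw := hK hN₁ hN₂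
          rw [Real.rpow_zero, mul_one] at hw
          have hsqrt_le : Real.sqrt ((t₁ * h₁ : ℕ) : ℝ) * Real.sqrt ((t₂ * h₂ : ℕ) : ℝ) ≤
              Real.sqrt (((d₁ * (t₁ * h₁) : ℕ) : ℝ) * ((d₂ * (t₂ * h₂) : ℕ) : ℝ)) := by
            rw [← Real.sqrt_mul (Nat.cast_nonneg _)]
            refine Real.sqrt_le_sqrt ?_
            have e₁ : ((t₁ * h₁ : ℕ) : ℝ) ≤ ((d₁ * (t₁ * h₁) : ℕ) : ℝ) := by
              exact_mod_cast Nat.le_mul_of_pos_left _ hd₁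
            have e₂ : ((t₂ * h₂ : ℕ) : ℝ) ≤ ((d₂ * (t₂ * h₂) : ℕ) : ℝ) := by
              exact_mod_cast Nat.le_mul_of_pos_left _ hd₂
            exact mul_le_mul e₁ e₂ (Nat.cast_nonneg _) (Nat.cast_nonneg _)
          have hs : ‖((Real.sqrt ((t₁ * h₁ : ℕ) : ℝ) * Real.sqrt ((t₂ * h₂ : ℕ) : ℝ) : ℝ) : ℂ)‖ =
              Real.sqrt ((t₁ * h₁ : ℕ) : ℝ) * Real.sqrt ((t₂ * h₂ : ℕ) : ℝ) := by
            rw [Complex.norm_real, Real.norm_eq_abs, abs_of_nonneg (by positivity)]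
          rw [norm_mul, hs]
          calc _ ≤ ‖(((((d₁ * (t₁ * h₁) : ℕ) : ℝ) * ((d₂ * (t₂ * h₂) : ℕ) : ℝ)) ^ (-(1 / 2 : ℝ)) : ℝ) : ℂ) *
                  afeW (KMV2000.qhat q) i j (d₁ * (t₁ * h₁)) (d₂ * (t₂ * h₂))‖ *
                Real.sqrt (((d₁ * (t₁ * h₁) : ℕ) : ℝ) * ((d₂ * (t₂ * h₂) : ℕ) : ℝ)) :=
              mul_le_mul_of_nonneg_left hsqrt_le (norm_nonneg _)
            _ ≤ K * L := by rw [hL]; exact hw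
        · rw [norm_zero]; positivity
      exact pow_le_pow_left₀ (norm_nonneg _) key 2
    · rw [if_neg hY, if_neg hY]
      split_ifs <;> simp
  -- the hyperbola count
  rw [sum_product]
  calc _ ≤ ∑ h₁ ∈ Icc 1 (q ^ 2 / d₁ / t₁), ∑ h₂ ∈ Icc 1 (q ^ 2 / d₂ / t₂),
          (if d₁ * (t₁ * h₁) * (d₂ * (t₂ * h₂)) ≤ Y then (K * L) ^ 2 else 0) :=
        sum_le_sum fun h₁ hh₁ ↦ sum_le_sum fun h₂ hh₂ ↦ hterm h₁ hh₁ h₂ hh₂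
    _ ≤ ∑ h₁ ∈ Icc 1 (q ^ 2 / d₁ / t₁), (K * L) ^ 2 * ((Y : ℝ) / (((d₁ * t₁ : ℕ) : ℝ) * ((d₂ * t₂ : ℕ) : ℝ) * h₁)) := by
        refine sum_le_sum fun h₁ hh₁ ↦ ?_
        rw [← sum_filter, sum_const, nsmul_eq_mul, mul_comm]
        exact mul_le_mul_of_nonneg_left (card_filter_class_hyperbola_le hd₁ hd₂ ht₁ ht₂ (mem_Icc.mp hh₁).1 _ Y)
          (by positivity)
    _ = (K * L) ^ 2 * ((Y : ℝ) / (((d₁ * t₁ : ℕ) : ℝ) * ((d₂ * t₂ : ℕ) : ℝ))) *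
          ∑ h₁ ∈ Icc 1 (q ^ 2 / d₁ / t₁), ((h₁ : ℝ))⁻¹ := by
        rw [mul_sum]
        refine sum_congr rfl fun h₁ _ ↦ ?_
        have hdt₁0 : (0 : ℝ) < ((d₁ * t₁ : ℕ) : ℝ) := by exact_mod_cast hdt₁
        have hdt₂0 : (0 : ℝ) < ((d₂ * t₂ : ℕ) : ℝ) := by exact_mod_cast hdt₂
        field_simp
    _ ≤ (K * L) ^ 2 * ((Y : ℝ) / (((d₁ * t₁ : ℕ) : ℝ) * ((d₂ * t₂ : ℕ) : ℝ))) * (1 + 2 * Real.log q) :=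
        mul_le_mul_of_nonneg_left (sum_Icc_inv_le_one_add_two_log hq1
          ((Nat.div_le_self _ _).trans (Nat.div_le_self _ _))) (by positivity)
    _ = _ := by rw [hL]; ring

end Summit.Parity.GeneralizedHardyLittlewood.Theorems.MomentsBeyondDiagonal.Layers

end
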